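import Summits.CriticalPhenomena.PercolationContinuityZ3.Theorems.Transplant.SkelPhiRunExitPieces
import Summits.CriticalPhenomena.PercolationContinuityZ3.Theorems.Transplant.SkelPhiOrientation
import HarnessLib

/-!
# N1 (the `{±1}` node), LEVEL 1, kit adapter file N-K8e: THE EXIT GOALS OF THE EIGHT SHORT PIECES — for a kit centre `c`, the run's long data
# `(n_L, h_L)` and the kit pair's data `(n_s, h_s, ℓ_s)` drawn EITHER in the run's chart `φ` OR in the transposed chart `trφ φ` (the kit pair's own
# orientation, stmt-g14 (L3)), lower bounds for the two exit quantities `e·α_c(w)` (raw sides) and `e·β′_L,c(w)` (level sides) on: the side half /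
# top piece × same / transposed orientation, with the signs chosen per case (stmt-g14 (L2): far slopes ⇒ side half, close slopes ⇒ top piece);
# plus the three integer inequalities that turn them into the placement `L(φ v) + A + C ≤ L(φ c)` under the ledger's floors

builds on p205010 (kernel theorem, internal audit signed; external expert review pending) — nothing in this file uses p205010; nothing here is a
claim about the open node `SamePDropOfSkeletonNeg`.
Lane `prim-bschramm`, seat `prim-bschramm-p1` (gen 11; design KIT-APRON-N1); helper file (`--supports stmt-CriticalPhenomena-4575 --as helper`).
* §0 `sgnz`, `sgnz_mul_self`, `sgnz_cases`, `shearCoord_trφ`;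
* §1 `rawGoal_same_half`, `rawGoal_tr_half`, `rawGoal_tr_top`, `levGoal_same_half`, `levGoal_same_top`, `levGoal_tr_half`, `levGoal_tr_top`;
* §2 `sameTop_arith`, `trTop_arith`, `trTopRaw_arith`.
[cite: MartineauTassion2017, §3.2 (the pieces)] [cite: KozmaNitzan2024, §4 p. 20 (Step IV)]
-/

noncomputable section

open scoped Classical

namespace Summit.CriticalPhenomena.PercolationContinuityZ3.Theorems.Transplant

namespace Skelφ

open Literature.Probability.Percolation Literature.Probability.LatticeModels SimpleGraph

variable {V : Type} {G : SimpleGraph V} [G.LocallyFinite] {φ : V → Site 2}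

/-! ## §0 Signs; the transposed shear -/

/-- The sign of an integer as `±1` (`0 ↦ 1`). [folklore] -/
def sgnz (x : ℤ) : ℤ := if 0 ≤ x then 1 else -1

omit [G.LocallyFinite] in
/-- `sgnz x · x = |x|`. [folklore] -/
theorem sgnz_mul_self (x : ℤ) : sgnz x * x = |x| := by
  unfold sgnz; split_ifs with h
  · rw [one_mul, abs_of_nonneg h]
  · rw [abs_of_neg (by omega)]; ring

omit [G.LocallyFinite] in
/-- `sgnz x = ±1`. [folklore] -/
theorem sgnz_cases (x : ℤ) : sgnz x = 1 ∨ sgnz x = -1 := by unfold sgnz; split_ifs <;> simp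

omit [G.LocallyFinite] in
/-- The transposed chart's relative coordinates and shear: `α^T = β`, `β′^T_{n,h} = n·α − h·β`. [folklore] -/
theorem shearCoord_trφ (c : V) (n : ℕ) (h : ℤ) (w : V) :
    relCoord (trφ φ) c 0 w = relCoord φ c 1 w ∧ shearCoord (trφ φ) c n h w = (n : ℤ) * relCoord φ c 0 w - h * relCoord φ c 1 w := by
  refine ⟨relCoord_trφ φ c 0 w, ?_⟩
  simp only [shearCoord_apply, relCoord_apply, trφ_apply]
  rfl

/-! ## §1 The exit quantities on the eight pieces -/

section Goals

variable {c w : V} {nS ℓS RS : ℕ} {hS : ℤ} {nL : ℕ} {hL : ℤ} {e τ v : ℤ}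

/-- SAME orientation, SIDE HALF `(e, τ)`: `e·α = n_s`. [folklore] -/
theorem rawGoal_same_half (he : e = 1 ∨ e = -1) (hw : w ∈ pgSideHalfW G φ c nS hS ℓS RS e τ) : e * relCoord φ c 0 w = nS := by
  obtain ⟨-, -, hα, -⟩ := (mem_pgSideHalfW G φ).1 hw
  rw [hα, ← mul_assoc]
  rcases he with rfl | rfl <;> simp

/-- TRANSPOSED orientation, SIDE HALF `(e·sgnz h_s, e)`: `e·α ≥ |h_s|` (`1 ≤ n_s`). [this work] -/
theorem rawGoal_tr_half (he : e = 1 ∨ e = -1) (hnS : 1 ≤ nS) (hw : w ∈ pgSideHalfW G (trφ φ) c nS hS ℓS RS (e * sgnz hS) e) :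
    |hS| ≤ e * relCoord φ c 0 w := by
  obtain ⟨-, -, hβ, hy⟩ := (mem_pgSideHalfW G (trφ φ)).1 hw
  obtain ⟨h0, hsh⟩ := shearCoord_trφ (φ := φ) c nS hS w
  rw [h0] at hβ
  rw [hsh, hβ] at hy
  have he2 : e * e = 1 := by rcases he with rfl | rfl <;> simp
  have hs := sgnz_mul_self hS
  have hnS0 : (0 : ℤ) < nS := by exact_mod_cast hnS
  -- `e·(n α − h·(e s n)) ≥ 0` ⇒ `n (e α) ≥ |h| n`
  have h1 : (nS : ℤ) * |hS| ≤ (nS : ℤ) * (e * relCoord φ c 0 w) := by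
    have : 0 ≤ e * ((nS : ℤ) * relCoord φ c 0 w) - hS * (e * (e * sgnz hS * nS)) := by nlinarith
    have e1 : hS * (e * (e * sgnz hS * nS)) = (e * e) * (sgnz hS * hS) * nS := by ring
    rw [e1, he2, hs, one_mul] at this
    nlinarith
  exact le_of_mul_le_mul_left h1 hnS0

/-- TRANSPOSED orientation, TOP PIECE `(e, τ, v)`: `n_s·(e·α) ≥ n_s ℓ_s − U_s + 1 − |h_s|·n_s`. [this work] -/
theorem rawGoal_tr_top (he : e = 1 ∨ e = -1) (hw : w ∈ pgTopPieceW G (trφ φ) c nS hS ℓS RS e τ v) :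
    (nS : ℤ) * ℓS - shearUnit nS hS + 1 - |hS| * nS ≤ (nS : ℤ) * (e * relCoord φ c 0 w) := by
  obtain ⟨-, hcyl, htop, -⟩ := (mem_pgTopPieceW G (trφ φ)).1 hw
  rw [mem_pgramCyl] at hcyl
  obtain ⟨h0, hsh⟩ := shearCoord_trφ (φ := φ) c nS hS w
  have hβ := hcyl.1; rw [h0] at hβ
  rw [hsh] at htop
  have hU : ((shearUnit nS hS : ℕ) : ℤ) = ((nS + hS.natAbs : ℕ) : ℤ) := rfl
  rw [hU]
  have he1 : |e| = 1 := by rcases he with rfl | rfl <;> simp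
  have hb : |e * (hS * relCoord φ c 1 w)| ≤ |hS| * nS := by
    rw [abs_mul, he1, one_mul, abs_mul]; exact mul_le_mul_of_nonneg_left hβ (abs_nonneg _)
  rw [abs_le] at hb
  have : e * ((nS : ℤ) * relCoord φ c 0 w - hS * relCoord φ c 1 w) = (nS : ℤ) * (e * relCoord φ c 0 w) - e * (hS * relCoord φ c 1 w) := by ring
  linarith [hb.2]

/-- SAME orientation, SIDE HALF `(e·sgnz E, e)`, `E = n_L h_s − h_L n_s`: `e·β′_L ≥ |E|` (`1 ≤ n_s`). [this work] -/
theorem levGoal_same_half (he : e = 1 ∨ e = -1) (hnS : 1 ≤ nS)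
    (hw : w ∈ pgSideHalfW G φ c nS hS ℓS RS (e * sgnz ((nL : ℤ) * hS - hL * nS)) e) :
    |(nL : ℤ) * hS - hL * nS| ≤ e * shearCoord φ c nL hL w := by
  obtain ⟨-, -, hα, hy⟩ := (mem_pgSideHalfW G φ).1 hw
  have htr := shear_transfer (φ := φ) c nL nS hL hS w
  have he2 : e * e = 1 := by rcases he with rfl | rfl <;> simp
  have hs := sgnz_mul_self ((nL : ℤ) * hS - hL * nS)
  have hnS0 : (0 : ℤ) < nS := by exact_mod_cast hnS
  have h1 : (nS : ℤ) * |(nL : ℤ) * hS - hL * nS| ≤ (nS : ℤ) * (e * shearCoord φ c nL hL w) := by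
    have e1 : (nS : ℤ) * (e * shearCoord φ c nL hL w) = (nL : ℤ) * (e * shearCoord φ c nS hS w) +
        ((nL : ℤ) * hS - hL * nS) * (e * relCoord φ c 0 w) := by linear_combination e * htr
    have e2 : ((nL : ℤ) * hS - hL * nS) * (e * relCoord φ c 0 w) = (e * e) * (sgnz ((nL : ℤ) * hS - hL * nS) * ((nL : ℤ) * hS - hL * nS)) * nS := by
      rw [hα]; ring
    rw [e2, he2, hs, one_mul] at e1
    have : (0 : ℤ) ≤ (nL : ℤ) * (e * shearCoord φ c nS hS w) := by positivity
    linarith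
  exact le_of_mul_le_mul_left h1 hnS0

/-- SAME orientation, TOP PIECE `(e, τ, v)`: `n_s·(e·β′_L) ≥ n_L(n_s ℓ_s − U_s + 1) − |E|·n_s`. [this work] -/
theorem levGoal_same_top (he : e = 1 ∨ e = -1) (hw : w ∈ pgTopPieceW G φ c nS hS ℓS RS e τ v) :
    (nL : ℤ) * ((nS : ℤ) * ℓS - shearUnit nS hS + 1) - |(nL : ℤ) * hS - hL * nS| * nS ≤ (nS : ℤ) * (e * shearCoord φ c nL hL w) := by
  obtain ⟨-, hcyl, htop, -⟩ := (mem_pgTopPieceW G φ).1 hw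
  rw [mem_pgramCyl] at hcyl
  have hα := hcyl.1
  have htr := shear_transfer (φ := φ) c nL nS hL hS w
  have he1 : |e| = 1 := by rcases he with rfl | rfl <;> simp
  have hU : ((shearUnit nS hS : ℕ) : ℤ) = ((nS + hS.natAbs : ℕ) : ℤ) := rfl
  have hb : |e * (((nL : ℤ) * hS - hL * nS) * relCoord φ c 0 w)| ≤ |(nL : ℤ) * hS - hL * nS| * nS := by
    rw [abs_mul, abs_mul, he1, one_mul]; exact mul_le_mul_of_nonneg_left hα (abs_nonneg _)
  rw [abs_le] at hb
  have e1 : (nS : ℤ) * (e * shearCoord φ c nL hL w) = (nL : ℤ) * (e * shearCoord φ c nS hS w) + e * (((nL : ℤ) * hS - hL * nS) * relCoord φ c 0 w) := by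
    linear_combination e * htr
  have h2 : (nS : ℤ) * ℓS - shearUnit nS hS + 1 ≤ e * shearCoord φ c nS hS w := by rw [hU]; linarith [htop]
  have h3 := mul_le_mul_of_nonneg_left h2 (show (0 : ℤ) ≤ nL by positivity)
  linarith [hb.1]

/-- TRANSPOSED orientation, SIDE HALF `(e·sgnz X, −e·sgnz h_L)`, `X = n_L n_s − h_L h_s`: `e·β′_L ≥ |X|` (`1 ≤ n_s`). [this work] -/
theorem levGoal_tr_half (he : e = 1 ∨ e = -1) (hnS : 1 ≤ nS)
    (hw : w ∈ pgSideHalfW G (trφ φ) c nS hS ℓS RS (e * sgnz ((nL : ℤ) * nS - hL * hS)) (-e * sgnz hL)) :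
    |(nL : ℤ) * nS - hL * hS| ≤ e * shearCoord φ c nL hL w := by
  obtain ⟨-, -, hβ, hy⟩ := (mem_pgSideHalfW G (trφ φ)).1 hw
  obtain ⟨h0, hsh⟩ := shearCoord_trφ (φ := φ) c nS hS w
  rw [h0] at hβ
  rw [hsh] at hy
  have he2 : e * e = 1 := by rcases he with rfl | rfl <;> simp
  have hsX := sgnz_mul_self ((nL : ℤ) * nS - hL * hS)
  have hsL := sgnz_mul_self hL
  have hτ2 : sgnz hL * sgnz hL = 1 := by rcases sgnz_cases hL with h | h <;> simp [h]
  have hnS0 : (0 : ℤ) < nS := by exact_mod_cast hnS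
  -- `n_s β′_L = β X − h_L y` with `β = σ' n_s`, `y = n_s α − h_s β`
  have e1 : (nS : ℤ) * shearCoord φ c nL hL w =
      relCoord φ c 1 w * ((nL : ℤ) * nS - hL * hS) - hL * ((nS : ℤ) * relCoord φ c 0 w - hS * relCoord φ c 1 w) := by
    simp only [shearCoord_apply, relCoord_apply]; ring
  -- `−e h_L y = |h_L| (τ' y) ≥ 0`
  have e2 : -(e * (hL * ((nS : ℤ) * relCoord φ c 0 w - hS * relCoord φ c 1 w))) =
      |hL| * (-e * sgnz hL * ((nS : ℤ) * relCoord φ c 0 w - hS * relCoord φ c 1 w)) := by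
    rw [← hsL]; linear_combination (e * hL * ((nS : ℤ) * relCoord φ c 0 w - hS * relCoord φ c 1 w)) * hτ2
  have h2 : 0 ≤ -(e * (hL * ((nS : ℤ) * relCoord φ c 0 w - hS * relCoord φ c 1 w))) := by
    rw [e2]; exact mul_nonneg (abs_nonneg _) hy
  -- `e β X = n_s |X|`
  have e3 : e * (relCoord φ c 1 w * ((nL : ℤ) * nS - hL * hS)) = (nS : ℤ) * |(nL : ℤ) * nS - hL * hS| := by
    rw [hβ, ← hsX]; linear_combination (sgnz ((nL : ℤ) * nS - hL * hS) * ((nL : ℤ) * nS - hL * hS) * nS) * he2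
  have h1 : (nS : ℤ) * |(nL : ℤ) * nS - hL * hS| ≤ (nS : ℤ) * (e * shearCoord φ c nL hL w) := by
    have e4 : (nS : ℤ) * (e * shearCoord φ c nL hL w) = e * (relCoord φ c 1 w * ((nL : ℤ) * nS - hL * hS)) +
        -(e * (hL * ((nS : ℤ) * relCoord φ c 0 w - hS * relCoord φ c 1 w))) := by linear_combination e * e1
    rw [e4, e3]; linarith
  exact le_of_mul_le_mul_left h1 hnS0

/-- TRANSPOSED orientation, TOP PIECE `(−e·sgnz h_L, τ, v)`: `n_s·(e·β′_L) ≥ |h_L|(n_s ℓ_s − U_s + 1) − n_s·|X|`. [this work] -/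
theorem levGoal_tr_top (he : e = 1 ∨ e = -1) (hw : w ∈ pgTopPieceW G (trφ φ) c nS hS ℓS RS (-e * sgnz hL) τ v) :
    |hL| * ((nS : ℤ) * ℓS - shearUnit nS hS + 1) - (nS : ℤ) * |(nL : ℤ) * nS - hL * hS| ≤ (nS : ℤ) * (e * shearCoord φ c nL hL w) := by
  obtain ⟨-, hcyl, htop, -⟩ := (mem_pgTopPieceW G (trφ φ)).1 hw
  rw [mem_pgramCyl] at hcyl
  obtain ⟨h0, hsh⟩ := shearCoord_trφ (φ := φ) c nS hS w
  have hβ := hcyl.1; rw [h0] at hβ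
  rw [hsh] at htop
  have he2 : e * e = 1 := by rcases he with rfl | rfl <;> simp
  have he1 : |e| = 1 := by rcases he with rfl | rfl <;> simp
  have hsL := sgnz_mul_self hL
  have hτ2 : sgnz hL * sgnz hL = 1 := by rcases sgnz_cases hL with h | h <;> simp [h]
  have hU : ((shearUnit nS hS : ℕ) : ℤ) = ((nS + hS.natAbs : ℕ) : ℤ) := rfl
  rw [hU]
  have e1 : (nS : ℤ) * shearCoord φ c nL hL w =
      relCoord φ c 1 w * ((nL : ℤ) * nS - hL * hS) - hL * ((nS : ℤ) * relCoord φ c 0 w - hS * relCoord φ c 1 w) := by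
    simp only [shearCoord_apply, relCoord_apply]; ring
  have e2 : -(e * (hL * ((nS : ℤ) * relCoord φ c 0 w - hS * relCoord φ c 1 w))) =
      |hL| * (-e * sgnz hL * ((nS : ℤ) * relCoord φ c 0 w - hS * relCoord φ c 1 w)) := by
    rw [← hsL]; linear_combination (e * hL * ((nS : ℤ) * relCoord φ c 0 w - hS * relCoord φ c 1 w)) * hτ2
  have hm : ((nS : ℤ) * ℓS - ((nS + hS.natAbs : ℕ) : ℤ) + 1) ≤ -e * sgnz hL * ((nS : ℤ) * relCoord φ c 0 w - hS * relCoord φ c 1 w) := by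
    linarith [htop]
  have h2 : |hL| * ((nS : ℤ) * ℓS - ((nS + hS.natAbs : ℕ) : ℤ) + 1) ≤ -(e * (hL * ((nS : ℤ) * relCoord φ c 0 w - hS * relCoord φ c 1 w))) := by
    rw [e2]; exact mul_le_mul_of_nonneg_left hm (abs_nonneg _)
  have hb : |e * (relCoord φ c 1 w * ((nL : ℤ) * nS - hL * hS))| ≤ (nS : ℤ) * |(nL : ℤ) * nS - hL * hS| := by
    rw [abs_mul, abs_mul, he1, one_mul]; exact mul_le_mul_of_nonneg_right hβ (abs_nonneg _)
  rw [abs_le] at hb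
  have e4 : (nS : ℤ) * (e * shearCoord φ c nL hL w) = e * (relCoord φ c 1 w * ((nL : ℤ) * nS - hL * hS)) +
      -(e * (hL * ((nS : ℤ) * relCoord φ c 0 w - hS * relCoord φ c 1 w))) := by linear_combination e * e1
  rw [e4]; linarith [hb.1]

end Goals

/-! ## §2 The three integer inequalities under the ledger's floors -/

/-- **Same orientation, top piece**: `2(A + n_L)·n_s ≤ n_L(n_s ℓ_s − U_s + 1)` from `ℓ_s ≥ 22M_z + 57`, `|h_s| ≤ 10 n_s`, `|h_L| ≤ 10 n_L`,
`A = (M_z+1)(n_L+|h_L|) + 1`. [this work] -/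
theorem sameTop_arith {nL nS ℓS Mz : ℕ} {hL hS A : ℤ} (hnL : 1 ≤ nL) (hnS : 1 ≤ nS) (hκS : |hS| ≤ 10 * (nS : ℤ)) (hκL : |hL| ≤ 10 * (nL : ℤ))
    (hℓ : 22 * Mz + 57 ≤ ℓS) (hA : A = (Mz + 1 : ℕ) * ((nL : ℤ) + |hL|) + 1) :
    2 * (A + nL) * (nS : ℤ) ≤ (nL : ℤ) * ((nS : ℤ) * ℓS - shearUnit nS hS + 1) := by
  have hU : ((shearUnit nS hS : ℕ) : ℤ) = nS + |hS| := by unfold shearUnit; push_cast; rfl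
  rw [hU, hA]; push_cast
  have hℓ' : (22 : ℤ) * Mz + 57 ≤ ℓS := by exact_mod_cast hℓ
  have h0 : (0 : ℤ) ≤ Mz := by positivity
  have hnL' : (1 : ℤ) ≤ nL := by exact_mod_cast hnL
  have hnS' : (1 : ℤ) ≤ nS := by exact_mod_cast hnS
  have haL : (0 : ℤ) ≤ |hL| := abs_nonneg _
  -- `A + n_L ≤ (11 M_z + 12) n_L + 1`
  have h1 : ((Mz : ℤ) + 1) * |hL| ≤ ((Mz : ℤ) + 1) * (10 * nL) := mul_le_mul_of_nonneg_left hκL (by linarith)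
  have hA1 : ((Mz : ℤ) + 1) * (nL + |hL|) + 1 + nL ≤ (11 * Mz + 12) * nL + 1 := by linear_combination h1
  have t1 := mul_le_mul_of_nonneg_right hA1 (show (0 : ℤ) ≤ 2 * nS by linarith)
  -- `n_L(n_s ℓ_s − n_s − |h_s| + 1) ≥ n_L n_s (22 M_z + 46)`
  have h2 : (nS : ℤ) * (22 * Mz + 46) ≤ (nS : ℤ) * ((ℓS : ℤ) - 11) := mul_le_mul_of_nonneg_left (by linarith) (by linarith)
  have h2' : (nS : ℤ) * ((ℓS : ℤ) - 11) ≤ (nS : ℤ) * ℓS - (nS + |hS|) + 1 := by linarith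
  have h3 : (nL : ℤ) * ((nS : ℤ) * (22 * Mz + 46)) ≤ (nL : ℤ) * ((nS : ℤ) * ℓS - (nS + |hS|) + 1) :=
    mul_le_mul_of_nonneg_left (h2.trans h2') (by linarith)
  -- `2 n_s ((11 M_z + 12) n_L + 1) ≤ n_L n_s (22 M_z + 46)` using `2 n_s ≤ 2 n_s n_L`
  have h4 : (2 : ℤ) * nS ≤ 2 * nS * nL := by nlinarith
  have hnS0 : (0 : ℤ) ≤ nS := by linarith
  have hB : ((11 * (Mz : ℤ) + 12) * nL + 1) * (2 * nS) ≤ (nL : ℤ) * ((nS : ℤ) * (22 * Mz + 46)) := by linear_combination 11 * h4 + 20 * hnS0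
  linear_combination t1 + hB + h3

/-- **Transposed orientation, raw side, top piece** (`|h_s| ≤ M_z + 2`): `n_s(M_z + 3) ≤ n_s ℓ_s − U_s + 1 − |h_s| n_s` from `ℓ_s ≥ 2M_z + 7`,
`n_s ≥ M_z + 3`. [this work] -/
theorem trTopRaw_arith {nS ℓS Mz : ℕ} {hS : ℤ} (hnS : Mz + 3 ≤ nS) (hh : |hS| ≤ (Mz : ℤ) + 2) (hℓ : 2 * Mz + 7 ≤ ℓS) :
    (nS : ℤ) * (Mz + 3) ≤ (nS : ℤ) * ℓS - shearUnit nS hS + 1 - |hS| * nS := by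
  have hU : ((shearUnit nS hS : ℕ) : ℤ) = nS + |hS| := by unfold shearUnit; push_cast; rfl
  rw [hU]
  have h1 : (Mz : ℤ) + 3 ≤ nS := by exact_mod_cast hnS
  have h2 : (2 : ℤ) * Mz + 7 ≤ ℓS := by exact_mod_cast hℓ
  have h0 : (0 : ℤ) ≤ |hS| := abs_nonneg _
  have h3 : |hS| * (nS : ℤ) ≤ ((Mz : ℤ) + 2) * nS := mul_le_mul_of_nonneg_right hh (by linarith)
  have h4 : (nS : ℤ) * (2 * Mz + 7) ≤ (nS : ℤ) * ℓS := mul_le_mul_of_nonneg_left h2 (by linarith)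
  nlinarith

/-- **Transposed orientation, level side, top piece** (the close-slope regime `|X| < A + n_L`, `X = n_L n_s − h_L h_s`):
`2 n_s (A + n_L) ≤ |h_L|(n_s ℓ_s − U_s + 1)` from `n_s ≥ 22M_z + 58`, `ℓ_s ≥ 24M_z + 64`, `|h_s| ≤ 10 n_s`, `A = (M_z+1)(n_L + |h_L|) + 1`.
In this regime `5 n_L ≤ 53 |h_L|`. [this work] -/
theorem trTop_arith {nL nS ℓS Mz : ℕ} {hL hS A : ℤ} (hnL : 1 ≤ nL) (hnS : 22 * Mz + 58 ≤ nS) (hκS : |hS| ≤ 10 * (nS : ℤ))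
    (hℓ : 24 * Mz + 64 ≤ ℓS) (hA : A = (Mz + 1 : ℕ) * ((nL : ℤ) + |hL|) + 1) (hX : |(nL : ℤ) * nS - hL * hS| < A + nL) :
    2 * (nS : ℤ) * (A + nL) ≤ |hL| * ((nS : ℤ) * ℓS - shearUnit nS hS + 1) := by
  have hU : ((shearUnit nS hS : ℕ) : ℤ) = nS + |hS| := by unfold shearUnit; push_cast; rfl
  rw [hU]
  rw [hA] at hX ⊢; push_cast at hX ⊢
  have hnS' : (22 : ℤ) * Mz + 58 ≤ nS := by exact_mod_cast hnS
  have hℓ' : (24 : ℤ) * Mz + 64 ≤ ℓS := by exact_mod_cast hℓ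
  have h0 : (0 : ℤ) ≤ Mz := by positivity
  have hnL' : (1 : ℤ) ≤ nL := by exact_mod_cast hnL
  have haL : (0 : ℤ) ≤ |hL| := abs_nonneg _
  have haS : (0 : ℤ) ≤ |hS| := abs_nonneg _
  -- Step 1: `n_L n_s − |h_L||h_s| ≤ |X|`
  have h1 : (nL : ℤ) * nS - |hL| * |hS| ≤ |(nL : ℤ) * nS - hL * hS| := by
    have := abs_sub_abs_le_abs_sub ((nL : ℤ) * nS) (hL * hS)
    rw [abs_mul hL hS, abs_of_nonneg (by positivity : (0 : ℤ) ≤ (nL : ℤ) * nS)] at this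
    exact this
  -- Step 2: `n_L (n_s − M_z − 2) ≤ |h_L| (|h_s| + M_z + 1) ≤ |h_L| (10 n_s + M_z + 1)`
  have h2a : (nL : ℤ) * nS - |hL| * |hS| ≤ ((Mz : ℤ) + 1) * (nL + |hL|) + nL := by linarith
  have h2 : (nL : ℤ) * ((nS : ℤ) - Mz - 2) ≤ |hL| * (|hS| + Mz + 1) := by linear_combination h2a
  have h2' : |hL| * (|hS| + (Mz : ℤ) + 1) ≤ |hL| * (10 * nS + Mz + 1) := mul_le_mul_of_nonneg_left (by linarith) haL
  -- Step 3: `5 n_L ≤ 53 |h_L|`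
  have hpos : (0 : ℤ) < (nS : ℤ) - Mz - 2 := by linarith
  have h3b : (5 : ℤ) * (10 * nS + Mz + 1) ≤ 53 * ((nS : ℤ) - Mz - 2) := by linarith
  have h3c : |hL| * ((5 : ℤ) * (10 * nS + Mz + 1)) ≤ |hL| * (53 * ((nS : ℤ) - Mz - 2)) := mul_le_mul_of_nonneg_left h3b haL
  have h3d : (5 : ℤ) * nL * ((nS : ℤ) - Mz - 2) ≤ 53 * |hL| * ((nS : ℤ) - Mz - 2) := by nlinarith [h2, h2', h3c]
  have h3 : (5 : ℤ) * nL ≤ 53 * |hL| := le_of_mul_le_mul_right h3d hpos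
  have h4 : (1 : ℤ) ≤ |hL| := by
    by_contra hc; push Not at hc
    have : |hL| = 0 := by omega
    rw [this] at h3; linarith
  -- Step 4: the bound
  have hnS0 : (0 : ℤ) ≤ nS := by linarith
  have h5 : |hL| * ((nS : ℤ) * (24 * Mz + 53)) ≤ |hL| * ((nS : ℤ) * ℓS - (nS + |hS|) + 1) := by
    refine mul_le_mul_of_nonneg_left ?_ haL
    have : (nS : ℤ) * (24 * Mz + 53) ≤ (nS : ℤ) * ((ℓS : ℤ) - 11) := mul_le_mul_of_nonneg_left (by linarith) hnS0
    nlinarith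
  -- `10 n_s (A + n_L) ≤ 2 n_s (|h_L| (58 M_z + 111)) + 10 n_s ≤ 5 |h_L| n_s (24 M_z + 53)`
  have h6' := mul_le_mul_of_nonneg_left h3 (show (0 : ℤ) ≤ (Mz : ℤ) + 2 by linarith)
  have h6 : (5 : ℤ) * (((Mz : ℤ) + 2) * nL) ≤ 53 * (((Mz : ℤ) + 2) * |hL|) := by linear_combination h6'
  have u2 := mul_le_mul_of_nonneg_left h6 (show (0 : ℤ) ≤ 2 * nS by linarith)
  have h7' := mul_le_mul h4 (show (43 : ℤ) ≤ 4 * Mz + 43 by linarith) (by norm_num) haL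
  have h7 : (10 : ℤ) * nS ≤ nS * (|hL| * (4 * Mz + 43)) := by nlinarith [h7', hnS0]
  have hfinal : (10 : ℤ) * nS * (((Mz : ℤ) + 1) * (nL + |hL|) + 1 + nL) ≤ 5 * (|hL| * ((nS : ℤ) * ℓS - (nS + |hS|) + 1)) := by
    linear_combination u2 + h7 + 5 * h5
  linarith

end Skelφ

end Summit.CriticalPhenomena.PercolationContinuityZ3.Theorems.Transplant

end
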